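import Literature.NumberTheory.EllipticCurves.ZpExtensionGaloisTwistWeilDual
import Literature.NumberTheory.EllipticCurves.ZpExtensionGaloisTwistLocalLiftProofs
import Literature.NumberTheory.EllipticCurves.ArchimedeanKummerImageMaximal
import Literature.NumberTheory.EllipticCurves.ArchimedeanWeilPairingDuality
import Literature.NumberTheory.EllipticCurves.WeilPairingTateDual
import Literature.NumberTheory.GaloisRepresentations.ContinuousCupProductCompat
import Summits.BirchSwinnertonDyer.BirchSwinnertonDyer.Theorems.ByReductionTypeAtTwoMultTransportTwistedDescentDualControl
import HarnessLib

/-!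
# T-42-mult in the kernel, XXV: the dual Kummer condition at a REAL place (`δinf` of file XXIV′) — PROVED

Cell `bsd-2adic` (run/shared/lean/pub/bsd-2adic/), seat `bsd-2adic-t42` (BRIEF-T42), GEN 16. HONEST FRAMING:
research route; THEOREMS ONLY (no `def`, no named fact, no instance); nothing booked; nothing re-keyed
(RC-169); BSD is not proved by any of this. PARTITION: X5@2 multiplicative GV-transport rows (K4ᵐ B1·O1; the
residual `LIFT₃` of `hF3b`) × p = 2 — types-the-object-of; bears_on K4 items 19922 / 19923
(`--supports stmt-BirchSwinnertonDyer-19923`). Brick (δ∞) of HOME/t42/DESIGN-T42-ADDENDUM-17.md §A17.3: the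
hypothesis `δinf` of `levelTarget_of_local_alt` (file XXIV′ `…TwistedDescentLocalAlt.lean`), verbatim.

## What

At a real place `w` of `ℚ` the twists `χ_u`, `χ_{u'}` are trivial on `Γ_{ℚ_w}` (`Γ_ℝ ⊆ Gal(ℚ̄/ℚ_∞)`,
`ZpExtension.resGal_mem_kerSubgroup_of_infinitePlace`), so `E[2^J](χ_u)|_w`, `E[2^J](χ_{u'})|_w` and
`E[2^J]|_w` are identified by identity intertwining maps, the kernel of `twistedTorsionToLocalH1` is the local
Kummer condition `𝓛_w = ker(H¹(ℝ, E[2^J]) → H¹(ℝ, E))` (`kummerLocalConditionAt`), and the local Tate pairing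
`⟨a, H¹(w) y'⟩` with the twisted Weil dual `w` is the Weil cup product `a ∪ₑ y'` (adjoint naturality,
`ContPairing.cupProduct_adjoint`). The statement `δinf` — «`H¹(w) y'` annihilates `ker twistedTorsionToLocalH1^{(u)}`
⟹ `twistedTorsionToLocalH1^{(u')} y' = 0`» — is therefore the RIGHT-annihilator form of the maximal
isotropy of `𝓛_w` under `∪ₑ` at a real place (Milne *ADT* I Rem. 3.7 / Lemma 6.15; tree: isotropy
`cupProduct_eq_zero_of_mem_kummerLocalConditionAt_of_fact` (Poonen–Rains, discharged), archimedean perfectness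
`bijective_weilCupProduct_infinitePlace`, the count `natCard_galoisCohomology_one_torsion_le_sq_infinitePlace`,
and the counting lemma `forall_mem_apply_eq_zero_iff_of_isotropic_of_card_le` applied to the FLIPPED pairing).

* `twistedTorsionToLocalH1_eq_zero_of_exists_coboundary` — at a completion whose Galois group maps into
  `Gal(K̄/K_∞)`, a twisted class whose values become a coboundary in `E(K̄_w)` dies under `twistedTorsionToLocalH1`;
* **`dualKummerAtInfinity`** — the statement `δinf` of XXIV′, for every `W`, `κ`, `J`, `u u'`, alternating
  non-degenerate equivariant `e`, real `w`, injective `ι_w`.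

References: [MilneADT2006] I Thm. 2.13, Rem. 3.7, Lemma 6.15; [GreenbergLNM1716] §4 p. 109 («for archimedean
`v` one easily verifies `𝒫^{(v)}(F) ≅ 𝒫^{(v)}(F_∞)^Γ`»); [PoonenRains2012] Prop. 4.8.
-/

set_option autoImplicit false
set_option linter.dupNamespace false

noncomputable section

open scoped Classical ContRepresentation

universe u

namespace Summit.BirchSwinnertonDyer.BirchSwinnertonDyer.Theorems.MultTransportTwistedDescent

open NumberField IsDedekindDomain Field WeierstrassCurve CategoryTheory
  Literature.NumberTheory.EllipticCurves Literature.NumberTheory.EllipticCurves.GreenbergVatsal2000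
  Literature.NumberTheory.GaloisRepresentations Literature.NumberTheory.GaloisCohomology
open Literature.NumberTheory.GaloisRepresentations.DiscreteGaloisModule (localTatePairingZMod localTatePairing
  tateDualPairingLocal unramifiedSubgroup SelmerStructure TateDual mu tateDualEval)

/-! ## Twisted classes at a completion inside `Gal(K̄/K_∞)` -/

section AnyField

variable {K : Type u} [Field K] (W : WeierstrassCurve K) (p : ℕ) [Fact p.Prime] (κ : ZpExtension K p)
  (J : ℕ) (u : ℤ) (hu : (p : ℤ) ∣ u - 1) (E : Type u) [Field E] [Algebra K E]

/-- If the values of a twisted cocycle `ξ : Γ_E → E[p^J]` become a coboundary `σ Q − Q` in `E(K̄_E)`, its class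
dies under `twistedTorsionToLocalH1` (the pulled-back cocycle on the local subgroup is the same coboundary).
[cite: SerreGaloisCohomology1997, I §2.4] -/
theorem twistedTorsionToLocalH1_eq_zero_of_exists_coboundary
    (ξ : contOneCocycles ((W.twistedTorsionGaloisModule p κ J u hu).restrictField E).toTopRep)
    (hξ : ∃ Q : localPoints W E, ∀ σ : absoluteGaloisGroup E,
      pointsMap W E ((ξ.1 σ : W.geomTorsion ((p ^ J : ℕ) : ℤ)) : W.geomPoints) = σ • Q - Q) :
    W.twistedTorsionToLocalH1 p κ J u hu E (oneCocycleClass _ ξ) = 0 := by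
  obtain ⟨Q, hQ⟩ := hξ
  rw [twistedTorsionToLocalH1_oneCocycleClass]
  refine (oneCocycleClass_eq_zero_iff _ _).mpr ⟨Q, fun τ ↦ ?_⟩
  have e0 : (contOneCocycles.pullback _ (W.twistedTorsionLocalHom p κ J u hu E) ξ).1 τ =
      pointsMap W E ((ξ.1 (τ : absoluteGaloisGroup E) : W.geomTorsion ((p ^ J : ℕ) : ℤ)) : W.geomPoints) := rfl
  rw [e0, hQ]
  rfl

end AnyField

/-! ## `δinf` over any number field -/

section NumberField

variable {K : Type u} [Field K] [NumberField K] (W : WeierstrassCurve K) [W.IsElliptic] (p : ℕ)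
  [Fact p.Prime] (κ : ZpExtension K p) (J : ℕ) {u u' : ℤ} (hu : (p : ℤ) ∣ u - 1) (hu' : (p : ℤ) ∣ u' - 1)
  (huu' : ((p : ℤ) ^ J) ∣ u * u' - 1)
  (e : W.geomTorsion ((p ^ J : ℕ) : ℤ) → W.geomTorsion ((p ^ J : ℕ) : ℤ) → AlgebraicClosure K)
  (hμ : ∀ S T, e S T ^ (p ^ J) = 1)
  (hadd₁ : ∀ S₁ S₂ T, e (S₁ + S₂) T = e S₁ T * e S₂ T)
  (hadd₂ : ∀ S T₁ T₂, e S (T₁ + T₂) = e S T₁ * e S T₂)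
  (hgal : ∀ (σ : absoluteGaloisGroup K) (S T : W.geomTorsion ((p ^ J : ℕ) : ℤ)),
    σ • e S T = e (σ • S) (σ • T))
  (halt : ∀ T, e T T = 1) (hnondeg : ∀ T, (∀ S, e S T = 1) → T = 0)
  [Finite (W.geomTorsion ((p ^ J : ℕ) : ℤ))]

include halt hnondeg in
/-- **The dual Kummer condition at an infinite place, any number field.** For `y' ∈ H¹(Γ_{K_w}, E[p^J](χ_{u'}))`
such that `ι_w ⟨a, H¹(w) y'⟩ = 0` for every `a ∈ ker twistedTorsionToLocalH1^{(u)}` (`ι_w` injective on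
`H²(K_w, μ)`, `w` the twisted Weil duality of an ALTERNATING non-degenerate equivariant `e`,
`u u' ≡ 1 mod p^J`): `twistedTorsionToLocalH1^{(u')} y' = 0`. On `Γ_{K_w}` both twists are trivial
(`resGal_mem_kerSubgroup_of_infinitePlace`), the kernels are the local Kummer condition `𝓛_w`, and
`⟨a, H¹(w)y'⟩ = a ∪ₑ y'`; `𝓛_w` is its own RIGHT annihilator under `ι_w ∘ ∪ₑ` (isotropy, archimedean
perfectness, `#H¹ ≤ (#𝓛_w)²`, counting). [cite: MilneADT2006, Ch. I, Rem. 3.7 and Lemma 6.15]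
[cite: GreenbergLNM1716, §4 p. 109] -/
theorem twistedTorsionToLocalH1_eq_zero_of_dual_infinitePlace (w : InfinitePlace K)
    (ιw : galoisCohomology ((mu K (p ^ J)).toLocal (Sum.inl w)) 2 →+ ZMod (p ^ J))
    (hι : Function.Injective ιw)
    (y' : galoisCohomology ((W.twistedTorsionGaloisModule p κ J u' hu').restrictField w.Completion) 1)
    (H : ∀ a : galoisCohomology ((W.twistedTorsionGaloisModule p κ J u hu).restrictField w.Completion) 1,
      W.twistedTorsionToLocalH1 p κ J u hu w.Completion a = 0 →
      localTatePairingZMod (W.twistedTorsionGaloisModule p κ J u hu) (p ^ J) (Sum.inl w) ιw a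
        (galoisCohomology.map
          ((W.twistedWeilDual p κ J hu hu' huu' e hμ hadd₁ hadd₂ hgal).restrictField w.Completion) 1 y') = 0) :
    W.twistedTorsionToLocalH1 p κ J u' hu' w.Completion y' = 0 := by
  haveI : NeZero (p ^ J) := ⟨pow_ne_zero _ (Fact.out : p.Prime).ne_zero⟩
  have hnZ : (((p ^ J : ℕ) : ℤ)) ≠ 0 := by exact_mod_cast pow_ne_zero J (Fact.out : p.Prime).ne_zero
  haveI := absoluteGaloisGroup_compactSpace w.Completion
  haveI := finite_absoluteGaloisGroup_completion_infinitePlace w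
  haveI := W.finite_galoisCohomology_one_torsion_restrictField_of_finite w.Completion hnZ
  haveI : CharZero w.Completion :=
    charZero_of_injective_algebraMap (algebraMap K w.Completion).injective
  have hres : ∀ σ : absoluteGaloisGroup w.Completion,
      absGaloisRestrict K w.Completion σ ∈ κ.kerSubgroup := fun σ ↦ by
    rw [← WeierstrassCurve.resGal_eq_absGaloisRestrict]
    exact ZpExtension.resGal_mem_kerSubgroup_of_infinitePlace κ w σ
  -- the twists are trivial on `Γ_{K_w}`
  have htw : ∀ (v : ℤ) (hv : (p : ℤ) ∣ v - 1) (σ : absoluteGaloisGroup w.Completion)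
      (P : W.geomTorsion ((p ^ J : ℕ) : ℤ)),
      W.twistedTorsionGaloisModule p κ J v hv (absGaloisRestrict K w.Completion σ) P =
        W.torsionGaloisModule ((p ^ J : ℕ) : ℤ) (absGaloisRestrict K w.Completion σ) P := fun v hv σ P ↦
    ZpExtension.galoisTwist_apply_of_mem_kerSubgroup _ _ _ _ _ _ (hres σ) P
  -- identity intertwining maps `θu : E[n]|w → E[n](χ_u)|w`, `θ' : E[n](χ_{u'})|w → E[n]|w`
  let θu : ((W.torsionGaloisModule ((p ^ J : ℕ) : ℤ)).restrictField w.Completion).toContRepresentation →ⁱL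
      ((W.twistedTorsionGaloisModule p κ J u hu).restrictField w.Completion).toContRepresentation :=
    { toContinuousLinearMap := ContinuousLinearMap.id ℤ _
      isIntertwining' := fun σ ↦ ContinuousLinearMap.ext fun P ↦ (htw u hu σ P).symm }
  let θ' : ((W.twistedTorsionGaloisModule p κ J u' hu').restrictField w.Completion).toContRepresentation →ⁱL
      ((W.torsionGaloisModule ((p ^ J : ℕ) : ℤ)).restrictField w.Completion).toContRepresentation :=
    { toContinuousLinearMap := ContinuousLinearMap.id ℤ _
      isIntertwining' := fun σ ↦ ContinuousLinearMap.ext fun P ↦ htw u' hu' σ P }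
  -- `β : E[n](χ_u)^D|w → E[n]|w`, `f ↦ w⁻¹ f`
  let βi : (((W.twistedTorsionGaloisModule p κ J u hu).tateDual (p ^ J)).restrictField
        w.Completion).toContRepresentation →ⁱL
      ((W.torsionGaloisModule ((p ^ J : ℕ) : ℤ)).restrictField w.Completion).toContRepresentation :=
    { toContinuousLinearMap := ((W.twistedWeilDualInv p κ J hu hu' huu' e hμ hadd₁ hadd₂ hgal
          hnondeg).restrictField w.Completion).toContinuousLinearMap
      isIntertwining' := fun σ ↦ by
        refine ContinuousLinearMap.ext fun f ↦ ?_
        have h := congrArg (fun L ↦ L f) (((W.twistedWeilDualInv p κ J hu hu' huu' e hμ hadd₁ hadd₂ hgal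
          hnondeg).restrictField w.Completion).isIntertwining' σ)
        exact h.trans (htw u' hu' σ _) }
  -- the untwisted class `x' = H¹(θ') y'`
  set x' := galoisCohomology.map θ' 1 y' with hx'
  -- the Weil cup-product pairing on `H¹(K_w, E[n])` through `ι_w`
  let P₁ := (weilContPairing W (p ^ J) e hμ hadd₁ hadd₂ hgal).restrict (absGaloisRestrict K w.Completion)
  let pr : galoisCohomology ((W.torsionGaloisModule ((p ^ J : ℕ) : ℤ)).restrictField w.Completion) 1 →+
      galoisCohomology ((W.torsionGaloisModule ((p ^ J : ℕ) : ℤ)).restrictField w.Completion) 1 →+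
        ZMod (p ^ J) :=
    AddMonoidHom.mk' (fun x => ιw.comp (P₁.cupProduct x).toAddMonoidHom)
      fun x x' => AddMonoidHom.ext fun y => by
        change ιw (P₁.cupProduct (x + x') y) = ιw (P₁.cupProduct x y) + ιw (P₁.cupProduct x' y)
        exact (congrArg ιw (DFunLike.congr_fun (map_add P₁.cupProduct x x') y)).trans (map_add ιw _ _)
  have hpr : ∀ x y, pr x y = ιw (P₁.cupProduct x y) := fun _ _ ↦ rfl
  have hbij := bijective_weilCupProduct_infinitePlace W (p ^ J) e hμ hadd₁ hadd₂ w hgal halt hnondeg ιw hι pr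
    hpr
  have hiso : ∀ x ∈ W.kummerLocalConditionAt ((p ^ J : ℕ) : ℤ) w.Completion,
      ∀ y ∈ W.kummerLocalConditionAt ((p ^ J : ℕ) : ℤ) w.Completion, P₁.cupProduct x y = 0 :=
    fun x hx y hy ↦ W.cupProduct_eq_zero_of_mem_kummerLocalConditionAt_of_fact (p ^ J) e hnZ
      (kummerClass_cupProduct_kummerClass_eq_zero_holds w.Completion) hμ hadd₁ hadd₂ halt hgal hx hy
  have hH : ∀ y : galoisCohomology ((W.torsionGaloisModule ((p ^ J : ℕ) : ℤ)).restrictField w.Completion) 1,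
      (p ^ J) • y = 0 :=
    nsmul_continuousCohomology_one_eq_zero _ (p ^ J)
      (fun T : W.geomTorsion ((p ^ J : ℕ) : ℤ) ↦ AddSubgroup.torsionBy.nsmul T)
  -- RIGHT annihilator of `𝓛_w` is `𝓛_w` (counting lemma for the flipped pairing)
  have key := forall_mem_apply_eq_zero_iff_of_isotropic_of_card_le pr.flip hH hbij.2.1
    (W.kummerLocalConditionAt ((p ^ J : ℕ) : ℤ) w.Completion)
    (W.kummerLocalConditionAt ((p ^ J : ℕ) : ℤ) w.Completion)
    (fun x hx y hy ↦ by rw [AddMonoidHom.flip_apply, hpr, hiso y hy x hx]; exact map_zero ιw)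
    (W.natCard_galoisCohomology_one_torsion_le_sq_infinitePlace w hnZ) x'
  -- `x' ∈ 𝓛_w`
  have hx'mem : x' ∈ W.kummerLocalConditionAt ((p ^ J : ℕ) : ℤ) w.Completion := by
    refine key.mp fun z hz ↦ ?_
    rw [AddMonoidHom.flip_apply, hpr]
    obtain ⟨ζ, rfl⟩ := oneCocycleClass_surjective _ z
    -- `a := H¹(θu) [ζ]` lies in the kernel of `twistedTorsionToLocalH1^{(u)}`
    have hz' := hz
    rw [WeierstrassCurve.mem_kummerLocalConditionAt_iff,
      WeierstrassCurve.map_torsionPointsMapIntertwining_oneCocycleClass] at hz'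
    obtain ⟨Q, hQ⟩ := (oneCocycleClass_eq_zero_iff _ _).mp hz'
    have hQ' : ∀ σ : absoluteGaloisGroup w.Completion,
        pointsMap W w.Completion ((ζ.1 σ : W.geomTorsion ((p ^ J : ℕ) : ℤ)) : W.geomPoints) = σ • Q - Q := hQ
    have ha0 : W.twistedTorsionToLocalH1 p κ J u hu w.Completion
        (galoisCohomology.map θu 1 (oneCocycleClass _ ζ)) = 0 := by
      rw [galoisCohomology.map_one_oneCocycleClass]
      exact twistedTorsionToLocalH1_eq_zero_of_exists_coboundary W p κ J u hu w.Completion _ ⟨Q, hQ'⟩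
    have hH1 := H _ ha0
    rw [DiscreteGaloisModule.localTatePairingZMod_apply] at hH1
    -- adjunction: `ev(H¹(θu) z, H¹(w) y') = z ∪ₑ H¹(β)(H¹(w) y')`
    have hadj := ContPairing.cupProduct_adjoint P₁
      (DiscreteGaloisModule.pairing ((W.twistedTorsionGaloisModule p κ J u hu).restrictField w.Completion)
        (((W.twistedTorsionGaloisModule p κ J u hu).tateDual (p ^ J)).restrictField w.Completion)
        ((mu K (p ^ J)).restrictField w.Completion)
        (tateDualEval K (W.geomTorsion ((p ^ J : ℕ) : ℤ)) (p ^ J))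
        (fun τ m f ↦ DiscreteGaloisModule.tateDualEval_smul (W.twistedTorsionGaloisModule p κ J u hu) (p ^ J) _ m f))
      (TopRep.ofHom ⟨θu.toContinuousLinearMap, θu.isIntertwining'⟩)
      (TopRep.ofHom ⟨βi.toContinuousLinearMap, βi.isIntertwining'⟩)
      (fun x f ↦ by
        have h := congrArg (fun g : TateDual K (W.geomTorsion ((p ^ J : ℕ) : ℤ)) (p ^ J) ↦ g x)
          (W.twistedWeilDual_inv_apply p κ J hu hu' huu' e hμ hadd₁ hadd₂ hgal hnondeg f)
        exact h.symm)
      (oneCocycleClass _ ζ)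
      (galoisCohomology.map
        ((W.twistedWeilDual p κ J hu hu' huu' e hμ hadd₁ hadd₂ hgal).restrictField w.Completion) 1 y')
    -- `H¹(β)(H¹(w|w) y') = x'`
    have hβ : galoisCohomology.map βi 1 (galoisCohomology.map
        ((W.twistedWeilDual p κ J hu hu' huu' e hμ hadd₁ hadd₂ hgal).restrictField w.Completion) 1 y') = x' := by
      obtain ⟨ξ, rfl⟩ := oneCocycleClass_surjective _ y'
      rw [hx', galoisCohomology.map_one_oneCocycleClass, galoisCohomology.map_one_oneCocycleClass,
        galoisCohomology.map_one_oneCocycleClass]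
      exact congrArg _ (Subtype.ext (ContinuousMap.ext fun σ ↦
        W.twistedWeilDualInv_apply p κ J hu hu' huu' e hμ hadd₁ hadd₂ hgal hnondeg (ξ.1 σ)))
    have h3 : localTatePairing (W.twistedTorsionGaloisModule p κ J u hu) (p ^ J) (Sum.inl w)
        (galoisCohomology.map θu 1 (oneCocycleClass _ ζ))
        (galoisCohomology.map
          ((W.twistedWeilDual p κ J hu hu' huu' e hμ hadd₁ hadd₂ hgal).restrictField w.Completion) 1 y') =
        P₁.cupProduct (oneCocycleClass _ ζ) x' := by
      rw [← hβ]
      exact hadj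
    have h4 := hH1
    rw [h3] at h4
    exact h4
  -- conclusion: the values of `y'` become a coboundary, so `twistedTorsionToLocalH1^{(u')} y' = 0`
  obtain ⟨ξ, rfl⟩ := oneCocycleClass_surjective _ y'
  rw [hx', galoisCohomology.map_one_oneCocycleClass, WeierstrassCurve.mem_kummerLocalConditionAt_iff,
    WeierstrassCurve.map_torsionPointsMapIntertwining_oneCocycleClass] at hx'mem
  obtain ⟨Q, hQ⟩ := (oneCocycleClass_eq_zero_iff _ _).mp hx'mem
  have hQ' : ∀ σ : absoluteGaloisGroup w.Completion,
      pointsMap W w.Completion ((ξ.1 σ : W.geomTorsion ((p ^ J : ℕ) : ℤ)) : W.geomPoints) = σ • Q - Q := hQ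
  exact twistedTorsionToLocalH1_eq_zero_of_exists_coboundary W p κ J u' hu' w.Completion ξ ⟨Q, hQ'⟩

end NumberField

/-! ## `δinf` (the hypothesis of `levelTarget_of_local_alt`, verbatim) -/

/-- **`δinf`: the dual Kummer condition at a real place of `ℚ`** — the hypothesis of
`levelTarget_of_local_alt` (file XXIV′ `…TwistedDescentLocalAlt.lean`), verbatim; from
`twistedTorsionToLocalH1_eq_zero_of_dual_infinitePlace`. [cite: MilneADT2006, Ch. I, Rem. 3.7 and Lemma 6.15]
[cite: GreenbergLNM1716, §4 p. 109] -/
theorem dualKummerAtInfinity :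
    ∀ (W : WeierstrassCurve ℚ) [W.IsElliptic] [W.IsGloballyMinimal],
      W.HasMultiplicativeReductionAtPrime 2 →
      ∀ (κ : ZpExtension ℚ 2) (_hκ : κ.IsCyclotomic) (J : ℕ) (u u' : ℤ) (hu : (2 : ℤ) ∣ u - 1)
        (hu' : (2 : ℤ) ∣ u' - 1) (huu' : ((2 : ℤ) ^ J) ∣ u * u' - 1)
        (e : W.geomTorsion ((2 ^ J : ℕ) : ℤ) → W.geomTorsion ((2 ^ J : ℕ) : ℤ) → AlgebraicClosure ℚ)
        (hμ : ∀ S T, e S T ^ (2 ^ J) = 1)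
        (hadd₁ : ∀ S₁ S₂ T, e (S₁ + S₂) T = e S₁ T * e S₂ T)
        (hadd₂ : ∀ S T₁ T₂, e S (T₁ + T₂) = e S T₁ * e S T₂)
        (hgal : ∀ (σ : absoluteGaloisGroup ℚ) (S T : W.geomTorsion ((2 ^ J : ℕ) : ℤ)),
          σ • e S T = e (σ • S) (σ • T))
        (_halt : ∀ T, e T T = 1) (_hnondeg : ∀ T, (∀ S, e S T = 1) → T = 0),
      ∀ [Finite (W.geomTorsion ((2 ^ J : ℕ) : ℤ))],
      ∀ (w : InfinitePlace ℚ)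
        (ιw : galoisCohomology ((DiscreteGaloisModule.mu ℚ (2 ^ J)).toLocal (Sum.inl w)) 2 →+ ZMod (2 ^ J)),
        Function.Injective ιw →
      ∀ (y' : galoisCohomology ((W.twistedTorsionGaloisModule 2 κ J u' hu').restrictField w.Completion) 1),
        (∀ a : galoisCohomology ((W.twistedTorsionGaloisModule 2 κ J u hu).restrictField w.Completion) 1,
          W.twistedTorsionToLocalH1 2 κ J u hu w.Completion a = 0 →
          localTatePairingZMod (W.twistedTorsionGaloisModule 2 κ J u hu) (2 ^ J) (Sum.inl w) ιw a
            (galoisCohomology.map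
              ((W.twistedWeilDual 2 κ J hu hu' huu' e hμ hadd₁ hadd₂ hgal).restrictField w.Completion)
              1 y') = 0) →
        W.twistedTorsionToLocalH1 2 κ J u' hu' w.Completion y' = 0 :=
  fun W _ _ _ κ _ J _ _ hu hu' huu' e hμ hadd₁ hadd₂ hgal halt hnondeg _ w ιw hι y' H ↦
    twistedTorsionToLocalH1_eq_zero_of_dual_infinitePlace W 2 κ J hu hu' huu' e hμ hadd₁ hadd₂ hgal halt hnondeg
      w ιw hι y' H

end Summit.BirchSwinnertonDyer.BirchSwinnertonDyer.Theorems.MultTransportTwistedDescent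

end
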